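/- Copyright: the b2b-balaban cell (near-miss cell 7), T⁴-continuum fan-out; row NE7b CRUX team (2), seat
t4-ne7b-formalise-leaf-01 (gen 72) — typist's build of the OWNER's INTERFACE REQUEST NE7b IR-101-3 «THE NON-TOWER ROUNDED END»
(OWNER t4-ne7b-p1 g101, journal l.49019 ∕ INBOX [NE7bP1-G101-INBOX-CLOSE]), item (a) of 2: the record.  Released under the licence
of the surrounding project. -/
import Summits.QuantumFields.BalabanUV.T4Continuum.Support.HistoryRealiseCellsRunAssemblyWTVSDataL
import Summits.QuantumFields.BalabanUV.T4Continuum.Support.HistoryBankingVolumeWindowLattice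

/-!
# THE (α) ASSEMBLY UNDER THE HEADLINE's OWN PREFIX, LATTICE-UNIT VOLUME LETTER, RENEWAL LETTER ROUNDED, part 1: THE BUNDLED
INPUTS `HistReadDataLWR` (INTERFACE REQUEST NE7b IR-101-3 (a); re-open object (α) of row NE7b; typist lineage `t4-ne7b-formalise-leaf-01`
gen 72)

Summits-side support leaf of the T⁴-continuum cell (rung (B)+1 on a FINITE torus only; NOT infinite volume, NOT the mass gap, NOT
the Clay statement; NOT a proof of the spine estimate NE7b — the cell's OWN estimate `T4WeightBudget.RelWeightBound`, NOT PRINTED,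
NOT PROVED).  [folklore] ONE `structure` (a hypothesis SHAPE: data + located displays + C-side letters, NOTHING of Bałaban's
asserted); no `[cite:]` tag, no `Prop` fact minted, zero `sorry`.  Append-only elsewhere: `HistReadDataLWL` (p303444), its road
(`…AssemblyWTVSLWLP82`, p303949) and every earlier record stay, UNCHANGED BY NAME AND TYPE; this is a SIBLING record with ONE
letter moved — the NON-tower twin of the OWNER's `B16HistoryTowerEndDataLWR.TowerReadDataLWR` (1R, p347096).

WHY (OWNER RULING R-ne7bp1-g101-5, journal l.48674, upholding pub-balaban-gaps ne6 g4's located objections π-gapsne6-g4-1 ∕ -2 and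
the refuter's σ-END-R1 ∕ σ-END-R1′; LOCATED OWNER FINDING F-ne7bp1-g101-2 «on the COUNT ROAD's END itself, not only on the tower
form»; INTERFACE REQUEST NE7b IR-101-3, l.49019).  `HistReadDataLWL.hF` pins run A's RENEWAL credit at the UNROUNDED letter
`S_h = sRunr …` (R-OWNER-47-1 (a)) = the LEFT member of [B16] p. 383's display after (1.78), CASE 2 of the `χ′` preparatory
function.  Print has FIVE preparatory factor kinds per component (pp. 381–383); CASE 1 (p. 382) yields only
`exp(−A₁²48⁻²R_j⁻⁸p₁²(g_j)) ≦ exp(−R_j⁻⁸p₁²(g_j))` (lit-balaban's PROVED transcription `B16Sect1Statements.prep382_case1_factor`),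
which EXCEEDS `exp(−S_h)` for large `R_j` (`S_h ~ R_j^{−(d+2)(1+β₀)}`): a factor reading at `S_h` is OVER-SHARP for Bałaban's
operations.  Print's own uniform statement is the ROUNDED one: *"exp(−R_j^{−d−5}p₁²(g_j)).  This is the largest factor among all
the small factors we have obtained from the large field characteristic functions in the preparatory steps.  We assume that
2p₁ − (d + 5)r₀ > p₀, and we estimate the factors by exp(−p₀(g_j))"* (p. 383, LOCATOR).  THIS RECORD therefore pins the renewal
letter at print's `r_h = (R_h^{d+5})⁻¹·(ℓ_h^{p₁})²` = `HistoryBankingSharpShares.sRsharp (O.d + 5) 1 p₁ (ℛ.R K) g^K h` (written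
INLINE; it is the OWNER's `B16HistoryTowerEndDataLWR.sRrnd D O p₁ g₀ ℛ.R K h` by `rfl`, no tower module imported) and books the
census at print's `t = d + 5`: `hexpR : p₀ + r·(d+5) + η = 2p₁` (print's «2p₁ − (d+5)r₀ > p₀» with the gap `η ≥ 1` named),
`hexpR′ : r(q′+1) + r(d+5) + η′ = 2p₁`.  The M5 rounding junction is ALREADY typed at generic `(t, Ap₁)`
(`HistoryBankingRoundingSupply.roundingRoomF_sharp_of_couplings`), so part (b)'s road is LWLP82's with `(t, Ap₁) := (d+5, 1)` and
NO unrounded envelope (the letter `Lr` and the rows `hAp`, `hLr`, `hβd` are GONE) — the OWNER's 2R junction (p347728) verbatim.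

WHAT.  **`structure HistReadDataLWR`** = `HistReadDataLWL` (p303444) FIELD FOR FIELD, with EXACTLY this delta (= 1R's delta
onto `TowerReadDataLWL`, copied onto the non-tower record):
* PARAMETERS: the real letter **`Lr` REMOVED** (it served only the unrounded envelope `ApFlat … Lr …`): `(cΛ M Φ β₀ : ℝ)`;
* `hF ↦` **`hF : ∀ K, K₀ ≤ K → FactorRead (Φf.fB K) (Φf.fR K) (sB K) (sRsharp (O.d + 5) 1 p₁ (ℛ.R K) (D.C ⟨K, F.m, g₀ K⟩).flow.g)`**
  and `upB`'s `sharpT (sB′ K) (·)` at the SAME rounded letter (R-class displays, as before — only the letter moved);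
* census rows **`hexpR : C.p₀ + rr * (O.d + 5) + η = 2 * p₁`**, **`hexpR′ : rr * (C.q′ + 1) + rr * (O.d + 5) + η′ = 2 * p₁`**
  (were `O.d + 3`; S-class census arithmetic);
* REMOVED rows: `hLr : 0 ≤ Lr`, `hAp : ApFlat O.γ₀ O.A₁ O.M Lr O.d ≠ 0`, `hβd : O.β₀ * (O.d + 2) ≤ 1` (unrounded-envelope only);
* KEPT VERBATIM: every other field, in LWL's order, with LWL's names and docstrings.
Non-vacuity of the SHAPE of the new census rows at PRINT-ADMISSIBLE letters (decided arithmetic, letters stay parameters — c6;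
the refuter g58's located point π-ne7bref-g58-1 and kernel `g58_joint_print_admissible` 19b214c20d90d985, journal l.49093): e.g.
`(d, rr, p₀, q′, p₁, η, η′, κ, κ₂, κᵥ) = (4, 1, 12, 10, 11, 1, 2, 13, 5, 19)` closes `hexpR` (12 + 9 + 1 = 22), `hexpR′`
(11 + 9 + 2 = 22), `hexpB` (11 + 13 = 24), `hexpFL`, `hdq`, `hexpVL` (1 + 4 + 19 = 24), print's proviso «2p₁ − (d+5)r₀ = 13 > 12 = p₀»
AND [IV] p. 183 «p₁ < p₀» (11 < 12) — the earlier cell witness `(p₀, p₁) = (8, 9)` closes the kernel rows but not print's «p₁ < p₀».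

HONEST SCOPE.  A bundling of HYPOTHESES; the R∕S class of every kept field is LWL's; nothing discharged here; ρ UNVALUED;
NEEDS-CONSTANT 0 (the rounding threshold of the road moves to `ellStar C O L (d+5) η η′ κ 1 Φ`; census numerals about OUR count are
balaban-calc's, kernel-invisible).  NE7b NOT proved; spine 0∕9.  HONEST DEPENDENCY (cell): continuum YM on T⁴ ⇐ BetaPertH ∧ nine
spine estimates (0/9 proved); BetaPertH ⇐ (D1) ∧ (D4) ∧ CAP+tail; G-an2-4 gates asym, D1 and NE2/3/4.  This file changes none of it.
-/

open Finset MeasureTheory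
open Literature.MathematicalPhysics.QuantumFieldTheory.Balaban1983to89
open T4PersistenceDictionary T4PersistentHistoryCount T4BankedInduction T4PrintedShapeBanking
open T4WeightBudget T4GlobalDenominator T4LiveClassFibration T4LiveStructureGas T4LiveGasToTerms T4RecordPriceSeam
open T4PartnerMultiplicity T4IndicatorShell T4MatchingAssembly T4MatchingClosure T4MatchingClosureSocket T4Continuum
open T4StabilitySocket T4BranchingRecordsGas T4TaggedShapeBanking T4CanonicalMenus T4RenewalChains
open Summit.QuantumFields.BalabanUV.T4Continuum.PlacementBatch Summit.QuantumFields.BalabanUV.T4Continuum.PlacementSkeleton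
open Summit.QuantumFields.BalabanUV.T4Continuum.CountThresholdUniform Summit.QuantumFields.BalabanUV.T4Continuum.CountThresholdExit
open Summit.QuantumFields.BalabanUV.T4Continuum.CountSeamJunction Summit.QuantumFields.BalabanUV.T4Continuum.LateMergers
open Summit.QuantumFields.BalabanUV.T4Continuum.HistoryFlow Summit.QuantumFields.BalabanUV.T4Continuum.HistoryRegeneration
open Summit.QuantumFields.BalabanUV.T4Continuum.HistoryTables Summit.QuantumFields.BalabanUV.T4Continuum.HistoryAssemblyTrees
open Summit.QuantumFields.BalabanUV.T4Continuum.HistoryAssemblyTerms Summit.QuantumFields.BalabanUV.T4Continuum.HistoryAssemblyPedigree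
open Summit.QuantumFields.BalabanUV.T4Continuum.HistoryConstants Summit.QuantumFields.BalabanUV.T4Continuum.HistoryGen
open Literature.MathematicalPhysics.QuantumFieldTheory.Balaban1983to89.B13ScaleTransfer
open Summit.QuantumFields.BalabanUV.T4Continuum.ZoneSkeleton Summit.QuantumFields.BalabanUV.T4Continuum.HistorySocketTH
open Summit.QuantumFields.BalabanUV.T4Continuum.HistoryCaps Summit.QuantumFields.BalabanUV.T4Continuum.HistoryAssemblyPrice
open Summit.QuantumFields.BalabanUV.T4Continuum.HistoryBankingLE Summit.QuantumFields.BalabanUV.T4Continuum.HistoryExitLE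
open Summit.QuantumFields.BalabanUV.T4Continuum.HistoryAssemblyTreesLE Summit.QuantumFields.BalabanUV.T4Continuum.HistoryAssemblyTermsLE
open Summit.QuantumFields.BalabanUV.T4Continuum.HistoryRealise Summit.QuantumFields.BalabanUV.T4Continuum.HistoryAssemblyRealiseLE
open Summit.QuantumFields.BalabanUV.T4Continuum.HistoryAssemblyMult Summit.QuantumFields.BalabanUV.T4Continuum.HistoryAssemblyMultKey
open Summit.QuantumFields.BalabanUV.T4Continuum.HistoryAssemblyRealiseRun Summit.QuantumFields.BalabanUV.T4Continuum.HistoryAssemblyRealiseMult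
open Summit.QuantumFields.BalabanUV.T4Continuum.HistoryZones Summit.QuantumFields.BalabanUV.T4Continuum.HistoryRealiseCells
open Summit.QuantumFields.BalabanUV.T4Continuum.HistoryRealiseCellsRun Summit.QuantumFields.BalabanUV.T4Continuum.HistoryAssemblyRealiseRunMult
open Summit.QuantumFields.BalabanUV.T4Continuum.HistoryRealiseCellsRunMult Summit.QuantumFields.BalabanUV.T4Continuum.HistoryAssemblyMultInstance
open Summit.QuantumFields.BalabanUV.T4Continuum.HistoryJoinsPlacedMember Summit.QuantumFields.BalabanUV.T4Continuum.PlacementSkeleton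
open Summit.QuantumFields.BalabanUV.T4Continuum.HistoryJoinsPlacedMult Summit.QuantumFields.BalabanUV.T4Continuum.HistoryRealiseDistinct
open Summit.QuantumFields.BalabanUV.T4Continuum.HistoryRegionTemplates Summit.QuantumFields.BalabanUV.T4Continuum.HistoryCaps
open Summit.QuantumFields.BalabanUV.T4Continuum.HistoryZoneEvolve (cth)
open Literature.MathematicalPhysics.QuantumFieldTheory.Balaban1983to89.B16SProfile (DropCtl)
open Summit.QuantumFields.BalabanUV.T4Continuum.HistoryRealiseCellsRunMultEnd Summit.QuantumFields.BalabanUV.T4Continuum.HistoryRealiseCellsRunMultEndD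
open Summit.QuantumFields.BalabanUV.T4Continuum.HistoryRealiseCellsRunPinnedT3b Summit.QuantumFields.BalabanUV.T4Continuum.HistoryHybridRescale
open Summit.QuantumFields.BalabanUV.T4Continuum.HistoryRealiseCellsRunApex (exists_const_schemeZ)
open Summit.QuantumFields.BalabanUV.T4Continuum.HistoryRealisePrint Summit.QuantumFields.BalabanUV.T4Continuum.HistoryRealiseWeak
open Summit.QuantumFields.BalabanUV.T4Continuum.HistoryRealisePrintReading Summit.QuantumFields.BalabanUV.T4Continuum.HistoryRealiseWeakReading
open Summit.QuantumFields.BalabanUV.T4Continuum.HistoryRealisePrintCells Summit.QuantumFields.BalabanUV.T4Continuum.HistoryRealiseWeakCells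
open Summit.QuantumFields.BalabanUV.T4Continuum.HistoryRealiseCellsRunApexT3b Summit.QuantumFields.BalabanUV.T4Continuum.HistoryRealiseCellsRunApexT3bW

open Summit.QuantumFields.BalabanUV.T4Continuum.HistoryRealiseCellsRunApexT3bWT Summit.QuantumFields.BalabanUV.T4Continuum.HistoryRealiseCellsRunPinnedT3bWT
open Summit.QuantumFields.BalabanUV.T4Continuum.HistoryRealiseCellsRunHeadlineT3bWT
open Summit.QuantumFields.BalabanUV.T4Continuum.HistoryRealiseCellsRunApexT3bWTV Summit.QuantumFields.BalabanUV.T4Continuum.HistoryBankingVolumePlug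
open Summit.QuantumFields.BalabanUV.T4Continuum.HistoryRealiseCellsRunApexT3bWTVS
open Summit.QuantumFields.BalabanUV.T4Continuum.HistoryGenealogyRealise
open Summit.QuantumFields.BalabanUV.T4Continuum.HistoryGenealogyInstantiate
open Summit.QuantumFields.BalabanUV.T4Continuum.B16HistoryIndexedRepr
open Summit.QuantumFields.BalabanUV.T4Continuum.B16HistoryIndexedTrunc
open Summit.QuantumFields.BalabanUV.T4Continuum.HistoryBankingDiscountCharge
open Summit.QuantumFields.BalabanUV.T4Continuum.HistoryBankingCreditRead
open Summit.QuantumFields.BalabanUV.T4Continuum.HistoryBankingFibreRoom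
open Summit.QuantumFields.BalabanUV.T4Continuum.HistoryPriceKeys
open Summit.QuantumFields.BalabanUV.T4Continuum.HistoryRealiseCellsRunSupplyWTVS
open Summit.QuantumFields.BalabanUV.T4Continuum.HistoryRealiseCellsRunSupplyKeysWTVS

open Summit.QuantumFields.BalabanUV.T4Continuum.HistoryRealiseCellsRunAssemblyWTVSData
open Summit.QuantumFields.BalabanUV.T4Continuum.HistoryRealiseCellsRunAssemblyWTVSDataL
open Summit.QuantumFields.BalabanUV.T4Continuum.HistoryBankingSharpShares (sBsharp sRsharp)
open Summit.QuantumFields.BalabanUV.T4Continuum.HistoryBankingVolumeWindowLattice (uvolL)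

namespace Summit.QuantumFields.BalabanUV.T4Continuum.HistoryRealiseCellsRunAssemblyWTVSDataLWR

noncomputable section

set_option synthInstance.maxSize 1024

/-! ## The bundled inputs under the prefix -/

section Data

variable {F : T4Family} {G : Type*} [GaugeGroup G] [MeasurableSpace G] [HaarData G] [RegularGaugeGroup G]

/-- **THE INPUTS OF THE (α) ASSEMBLY UNDER THE HEADLINE's OWN PREFIX, VOLUME LETTER IN LATTICE UNITS, RENEWAL LETTER
ROUNDED** (IR-101-3 (a); HYPOTHESIS SHAPE — data + located displays + C-side letters, NOTHING of Bałaban's asserted): `HistReadDataLWL`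
with the factor reading `hF` and run B's `upB` at print's ROUNDED renewal letter `sRsharp (O.d + 5) 1 p₁ (ℛ.R K) g^K` (`r_h`, `t = d+5`,
`Ap₁ = 1`; [B16] p. 383), the census rows `hexpR`∕`hexpR′` at `d + 5`, and the unrounded envelope's letter `Lr` and rows `hLr`∕`hAp`∕`hβd`
removed; the window-threshold letters `cΛ M Φ β₀ p₁ η η′ κ κ₂ κᵥ` are PARAMETERS (bound outside the prefix).  Every other field is
LWL's, verbatim. [folklore] -/
structure HistReadDataLWR (D : FiniteEpsData F G) (C : T4PrintedShapeBanking.Consts) (O : PrintedO1s) (θv : ℝ)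
    (rr d n : ℕ) (hn : 0 < n) (g₀ : ℕ → ℝ) (os : List (ULoop F))
    (cΛ M Φ β₀ : ℝ) (p₁ η η' κ κ₂ κᵥ : ℕ) {DomK : ℕ → Type}
    (I : (K : ℕ) → HIndex (DomK K)) [DecidableEq (HIndex.Idx I)] {DomK' : ℕ → Type} (I' : (K : ℕ) → HIndex (DomK' K))
    (X : ℕ → Type) [∀ K, MeasurableSpace (X K)] (μ : (K : ℕ) → Measure (X K)) [∀ K, IsFiniteMeasure (μ K)]
    (𝒢 : (K : ℕ) → GoodClass (X K)) (Y : ℕ → Type) [∀ K, MeasurableSpace (Y K)] (νB : (K : ℕ) → Measure (Y K))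
    [∀ K, IsFiniteMeasure (νB K)] (𝒢' : (K : ℕ) → GoodClass (Y K)) where
  /-- the source radius -/
  l₀ : ℝ
  /-- the volume factor of the matching remainders -/
  vol : ℝ
  /-- the source radius is positive -/
  l₀_pos : 0 < l₀
  /-- the volume factor is positive -/
  vol_pos : 0 < vol
  /-- the threshold in the number of steps -/
  K₀ : ℕ
  /-- M1∕M2-A: run A's history-indexed operations over the skeleton, per cutoff and source value -/
  RA : (K : ℕ) → ℝ → Repr172R (𝒢 K) (I K)
  /-- M1∕M2-A: run A's dressed density on its reference space -/
  ρA : (K : ℕ) → ℝ → X K → ℝ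
  /-- display ((1.72) holds): the density is the sum of the level's terms -/
  holdsA : ∀ K t V, ρA K t V = ∑ a : (I K).Adm, (RA K t).term a V
  /-- display (integrability of the elementary terms) -/
  intA : ∀ K t a, ∀ ι ∈ (I K).LIdx a, Integrable ((RA K t).eterm a ι) (μ K)
  /-- display (H2: the dressed push-forward identity) -/
  H2A : ∀ K t, |t| ≤ l₀ → K₀ ≤ K →
    ∫ U, Real.exp (t * T4GenFunBounds.prodObs (D.scheme g₀) K os U) * D.dens K (g₀ K) 0 U ∂fieldMeasure (F.P K) 0 G =
      ∫ x, ρA K t x ∂μ K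
  /-- M2-B: the reading of the history choices (regions, classes, cubes; flow, memory) -/
  ℛ : HistReading I d
  /-- (c1) the reading's blocking parameter is the family's -/
  hL : ℛ.L = F.L
  /-- (c1) the reading's exponent profile is the run's own -/
  hs : ℛ.s = runProfile F.L ℛ.R
  /-- M2-B: the factor values and envelopes -/
  Φf : HistFactors I d
  /-- display: THE identification `HistRead` -/
  hR : HistRead ℛ Φf RA l₀ K₀
  /-- display (2.5): the reading's sizes are admissible for the running couplings -/
  isRj : ∀ K s, s ≤ K → B14.IsRj F.L rr ((D.C ⟨K, F.m, g₀ K⟩).flow.g s) (ℛ.R K s)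
  /-- sizes are at least one -/
  one_le_R : ∀ K, K₀ ≤ K → ∀ t, 1 ≤ ℛ.R K t
  /-- flow (K): the blocking parameter is at least four -/
  hL4 : 4 ≤ F.L
  /-- flow (K): the run's own exponent profile is non-increasing within the run (`runProfile_succ_le`) -/
  hprof : ∀ K, K₀ ≤ K → ∀ t, t < K → runProfile F.L ℛ.R K (t + 1) ≤ runProfile F.L ℛ.R K t
  /-- flow (K): drop control of the run's own profile (`dropCtl_runProfile`) -/
  hdrop : ∀ K, K₀ ≤ K → ∀ m, DropCtl (runProfile F.L ℛ.R K) m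
  /-- pass-V input condition per term: new regions consistent -/
  hN : ∀ K, K₀ ≤ K → ∀ τ ∈ HIndex.termSet I K, (ℛ.inputOf.run K τ).NewOK
  /-- pass-V input condition per term: memory domination -/
  hRm : ∀ K, K₀ ≤ K → ∀ τ ∈ HIndex.termSet I K, ∀ t k, (ℛ.inputOf.run K τ).Rm t k ≤ (ℛ.inputOf.run K τ).R t
  /-- pass-V input condition per term: memory domination, one-step form -/
  hRmS : ∀ K, K₀ ≤ K → ∀ τ ∈ HIndex.termSet I K, ∀ t k, (ℛ.inputOf.run K τ).Rm t (k + 1) ≤ (ℛ.inputOf.run K τ).R (t + 1)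
  /-- pass-V input condition per term: non-degenerate memory -/
  hRm2 : ∀ K, K₀ ≤ K → ∀ τ ∈ HIndex.termSet I K, ∀ t, 2 ≤ (ℛ.inputOf.run K τ).Rm t 1
  /-- pass-V input condition per term: disjoint new regions -/
  hD : ∀ K, K₀ ≤ K → ∀ τ ∈ HIndex.termSet I K, (ℛ.inputOf.run K τ).NewDisjoint
  /-- pass-V input condition per term, THE INPUT DISPLAY OF R-OWNER-47-3 ∕ 48-1: every point of every new region lies in
  the torus' period box at its level (`RegionsInBox`; implies the junction's `InBoxOK` and the witness's `BoxedBirths`) -/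
  hreg : ∀ K, K₀ ≤ K → ∀ τ ∈ HIndex.termSet I K, (ℛ.inputOf.run K τ).RegionsInBox n K
  /-- constants: the window constant, the discount letters -/
  hn₁ : 13 ≤ C.n₁
  /-- constants -/
  hE₂ : 0 < C.E₂
  /-- constants — `E₃` STRICTLY positive, carried ONCE (W-ne7bp1-g49-1 (i): M5-2's `huE₃` ∕ leaf-06's `ellVol` force it;
  `HistReadDataL.hE₃ : 0 ≤ C.E₃` is its `le_of_lt`) -/
  hE₃pos : 0 < C.E₃
  /-- M5-3∕M5-4 letters per cutoff: sharp birth exponents -/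
  sB : ℕ → ℕ → ℕ → ℝ
  /-- fibre shares, births -/
  φB : ℕ → ℕ → ℕ → ℝ
  /-- fibre shares, renewals -/
  φR : ℕ → ℕ → ℝ
  /-- (2.9)∕(2.7)'s letter `β′` (the letter `β₀` is a PARAMETER of the record: the volume threshold reads it) -/
  β' : ℝ
  /-- display: the factor reading, the renewal exponent FIXED to print's ROUNDED letter `r_h = (R_h^{d+5})⁻¹·(ℓ_h^{p₁})²`
  ([B16] p. 383 «the largest factor among all the small factors … in the preparatory steps»; IR-101-3, R-ne7bp1-g101-5 — REPLACES
  LWL's unrounded `S_h = sRunr …` of R-OWNER-47-1 (a); `= B16HistoryTowerEndDataLWR.sRrnd D O p₁ g₀ ℛ.R K` by `rfl`) -/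
  hF : ∀ K, K₀ ≤ K → FactorRead (Φf.fB K) (Φf.fR K) (sB K) (sRsharp (O.d + 5) 1 p₁ (ℛ.R K) (D.C ⟨K, F.m, g₀ K⟩).flow.g)
  /-- display (2.9) on the reading's sizes -/
  h29 : ∀ K, K₀ ≤ K → B14FlowStep.FlowIneq29 (ℛ.R K) (D.C ⟨K, F.m, g₀ K⟩).flow.g F.L β' β₀ K
  /-- the term-free curly normalisation envelope -/
  W : ℕ → ℝ
  /-- display -/
  one_le_W : ∀ K, 1 ≤ W K
  /-- the term-free envelopes' K-uniform bounds -/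
  (Wi BAi mi : ℝ)
  /-- display -/
  hWi : ∀ K, W K ≤ Wi
  /-- display -/
  hBA : ∀ K t, |t| ≤ l₀ → K₀ ≤ K → Φf.BA K t ≤ BAi
  /-- display -/
  hmi : ∀ K, (μ K).real Set.univ ≤ mi
  /-- display (ρ) `FibreMass` (located, VOLUME type) -/
  hρ : ∀ K t, |t| ≤ l₀ → K₀ ≤ K →
    ∀ k ∈ badGMems (memA n F.L ℛ) jhalf (HIndex.termSet I) (kmemA n F.L hn (lt_of_lt_of_le (by norm_num) (two_le_L F)) ℛ) K,
      ∑ τ ∈ fibre (kmemA n F.L hn (lt_of_lt_of_le (by norm_num) (two_le_L F)) ℛ) (HIndex.termSet I) K k,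
        dmassOf ℛ Φf t τ ≤ W K * MULTOf (sharpT (φB K) (φR K)) k
  /-- the (γ) small-field mass floor -/
  c₀ : ℝ
  /-- the site budget -/
  n₁ : ℝ
  /-- the floor is positive -/
  c₀_pos : 0 < c₀
  /-- (γ) floor, run A -/
  floor : ∀ K, K₀ ≤ K → c₀ ≤ smallFieldMass D K (g₀ K)
  /-- (γ) floor, run B -/
  floor' : ∀ K, K₀ ≤ K → c₀ ≤ smallFieldMass D (K + 1) (g₀ (K + 1))
  /-- site budget, run A -/
  sites : ∀ K, K₀ ≤ K → ((D.C ⟨K, F.m, g₀ K⟩).numSites K : ℝ) ≤ n₁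
  /-- site budget, run B -/
  sites' : ∀ K, K₀ ≤ K → ((D.C ⟨K + 1, F.m, g₀ (K + 1)⟩).numSites (K + 1) : ℝ) ≤ n₁
  /-- RUN B v0.5: run B's history-indexed operations over ITS skeleton, per cutoff and source value -/
  RB : (K : ℕ) → ℝ → Repr172R (𝒢' K) (I' K)
  /-- RUN B: run B's dressed density after `K + 1` steps on its reference space -/
  ρB : (K : ℕ) → ℝ → Y (K + 1) → ℝ
  /-- display ((1.72) holds for run B at cutoff `K + 1`) -/
  holdsB : ∀ K t V, ρB K t V = ∑ a : (I' (K + 1)).Adm, (RB (K + 1) t).term a V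
  /-- display (integrability, run B) -/
  intB : ∀ K t a, ∀ ι ∈ (I' (K + 1)).LIdx a, Integrable ((RB (K + 1) t).eterm a ι) (νB (K + 1))
  /-- display (H2, run B) -/
  H2B : ∀ K t, |t| ≤ l₀ → K₀ ≤ K →
    ∫ U, Real.exp (t * T4GenFunBounds.prodObs (D.scheme g₀) (K + 1) os U) * D.dens (K + 1) (g₀ (K + 1)) 0 U
        ∂fieldMeasure (F.P (K + 1)) 0 G = ∫ y, ρB K t y ∂νB (K + 1)
  /-- RUN B (S, NODE O): the truncation of run B's level-`(K+1)` terms onto run A's index -/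
  trunc : ℕ → HIndex.Idx I' → HIndex.Idx I
  /-- display (S): the truncation maps run B's term set into run A's -/
  htr : ∀ K, K₀ ≤ K → ∀ τ' ∈ HIndex.termSet I' (K + 1), trunc K τ' ∈ HIndex.termSet I K
  /-- RUN B: per-term dead weights -/
  dB : ℕ → ℝ → HIndex.Idx I' → ℝ
  /-- RUN B: envelope -/
  mup : ℕ → ℝ → ℝ
  /-- RUN B: sharp ∕ share letters of run B -/
  (sB' φB' : ℕ → ℕ → ℕ → ℝ)
  /-- RUN B: share letters of run B, renewals -/
  φR' : ℕ → ℕ → ℝ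
  /-- display (R «TRUNC»): run B's numerator reading per term, KEYED AT RUN A's KEYS (IR-101-3: run B's sharp letters at the
  ROUNDED renewal letter, as `hF`) -/
  upB : ∀ K t, |t| ≤ l₀ → K₀ ≤ K →
    ∀ k ∈ badGMems (memA n F.L ℛ) jhalf (HIndex.termSet I) (kmemA n F.L hn (lt_of_lt_of_le (by norm_num) (two_le_L F)) ℛ) K,
      ∀ τ' ∈ HIndex.termSet I' (K + 1),
        trunc K τ' ∈ fibre (kmemA n F.L hn (lt_of_lt_of_le (by norm_num) (two_le_L F)) ℛ) (HIndex.termSet I) K k →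
          Repr172R.weight νB RB t τ' ≤
            dB K t τ' * LIVEOf C K (ℛ.R K) (fun m => 2 ^ (d + 3) * Real.log (Φf.Λ K m)) (sharpT (sB' K)
              (sRsharp (O.d + 5) 1 p₁ (ℛ.R K) (D.C ⟨K, F.m, g₀ K⟩).flow.g)) k *
              mup K t
  /-- display (R «TRUNC»): run B's dead weights are nonnegative over the composite fibres -/
  deadB_nonneg : ∀ K t, |t| ≤ l₀ → K₀ ≤ K →
    ∀ k ∈ badGMems (memA n F.L ℛ) jhalf (HIndex.termSet I) (kmemA n F.L hn (lt_of_lt_of_le (by norm_num) (two_le_L F)) ℛ) K,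
      ∀ τ' ∈ HIndex.termSet I' (K + 1),
        trunc K τ' ∈ fibre (kmemA n F.L hn (lt_of_lt_of_le (by norm_num) (two_le_L F)) ℛ) (HIndex.termSet I) K k →
          0 ≤ dB K t τ'
  /-- display (ρ′) (located, VOLUME type): run B's fibre mass over the COMPOSITE fibre of a key -/
  resumB : ∀ K t, |t| ≤ l₀ → K₀ ≤ K →
    ∀ k ∈ badGMems (memA n F.L ℛ) jhalf (HIndex.termSet I) (kmemA n F.L hn (lt_of_lt_of_le (by norm_num) (two_le_L F)) ℛ) K,
      ∑ τ' ∈ (HIndex.termSet I' (K + 1)).filter (fun τ' =>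
          trunc K τ' ∈ fibre (kmemA n F.L hn (lt_of_lt_of_le (by norm_num) (two_le_L F)) ℛ) (HIndex.termSet I) K k),
        dB K t τ' ≤ MULTOf (sharpT (φB' K) (φR' K)) k
  /-- display: run B's envelope bound (at `Nup := e^{BA∞}·m∞·W∞`) -/
  mup_bd : ∀ K t, |t| ≤ l₀ → K₀ ≤ K → 0 ≤ mup K t ∧ mup K t ≤ Real.exp BAi * mi * Wi
  /-- NE7c: the two runs' shell parts -/
  (shA shB : ℕ → ℝ → HIndex.Idx I → ℝ)
  /-- NE7c's shell weight budget -/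
  Wsh : ℕ → ℝ
  /-- NE7c (S): the indicator shells' relative weight bound over this reading's terms -/
  shell : ShellWeightBound l₀ (HIndex.termSet I) (fun _ t => Repr172R.weight μ RA t) (weightB νB RB trunc) shA shB Wsh
  /-- NE7 core budget data -/
  (Cc Rr CcRec RrRec : ℕ → ℝ → HIndex.Idx I → ℝ)
  /-- NE7 core budget rates -/
  (ν u s₂ q₀ r s : ℕ → ℝ)
  /-- NE7 (S): the re-indexed per-term budget over this reading's bad classes -/
  budget : ReindexedBudget l₀ vol (HIndex.termSet I) (fun K t τ => Repr172R.weight μ RA t τ - shA K t τ)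
    (fun K t τ => weightB νB RB trunc K t τ - shB K t τ)
    (badOfClass (bstrOf Prod.fst (memA n F.L ℛ)) (HIndex.termSet I)
      (fun K _ => badClasses Prod.fst (memA n F.L ℛ) jhalf (HIndex.termSet I) K)) Cc Rr CcRec RrRec ν u s₂ q₀ r s
  /-- summable rates -/
  sum_r : Summable r
  /-- summable rates -/
  sum_u : Summable u
  /-- summable rates -/
  sum_s : Summable s
  /-- summable rates -/
  sum_s₂ : Summable s₂
  /-- C-side: print's p. 380 volume constant is nonnegative -/
  hcΛ : 0 ≤ cΛ
  /-- C-side (IR-52-1 (a), ADDED): the cube-side letter `M` of the lattice volume letter `uvolL` is nonnegative (the name `hM`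
  is LW's sign row `0 < O.M`, kept verbatim below) -/
  hMΛ : 0 ≤ M
  /-- display (H3, M2-B; IR-52-1 (a): REPLACES LW's per-cube `hΛ`): the volume factor IS `e^{cΛ·(M·R_{t∧K})^d·ℓ_{t∧K}}` — [B16]
  p. 380 «O(1) log g_j⁻²|Z_j|» with `|Z_j|` counted in LATTICE sites (R-OWNER-49-2's currency (B), R-OWNER-52-3); its logarithm is
  leaf-06's lattice letter `uvolL` (`HistoryBankingVolumeWindowLattice` §1) on the reading's sizes `ℛ.R K` -/
  hΛL : ∀ K t, Real.log (Φf.Λ K t) = uvolL cΛ M d (D.C ⟨K, F.m, g₀ K⟩).flow.g (ℛ.R K) K t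
  /-- C-side: the volume slack is positive -/
  hθv : 0 < θv
  /-- C-side: the (2.9)∕(2.7) letter `β₀` is nonnegative -/
  hβ₀ : 0 ≤ β₀
  /-- C-side: the fibre's discount multiplier is nonnegative (Φ := 1 of record, R-OWNER-48-3) -/
  hΦ : 0 ≤ Φ
  /-- C-side: the birth-floor mass letter -/
  m : ℝ
  /-- C-side: `A₁² ≤ m` -/
  hm : O.A₁ ^ 2 ≤ m
  /-- census identity at print's ROUNDED letter (t = d+5; IR-101-3 — was `d+3`): `p₀ + r(d+5) + η = 2p₁`, i.e. [B16] p. 383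
  «we assume that 2p₁ − (d+5)r₀ > p₀» with the gap `η ≥ 1` named -/
  hexpR : C.p₀ + rr * (O.d + 5) + η = 2 * p₁
  /-- census identity at print's ROUNDED letter (t = d+5; IR-101-3): `r(q′+1) + r(d+5) + η′ = 2p₁` -/
  hexpR' : rr * (C.q' + 1) + rr * (O.d + 5) + η' = 2 * p₁
  /-- census identity: `r(q′+1) + κ = 2p₀` -/
  hexpB : rr * (C.q' + 1) + κ = 2 * C.p₀
  /-- census identity in LATTICE units (volume window vs the floor; IR-52-1 (a): REPLACES LW's per-cube row `1 + κ₂ = r·q′`):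
  one power `R_t^d` of the letter is paid by the floor `E₂·R_t^{q′}`, so `1 + κ₂ = r·(q′ − d)` -/
  hexpFL : 1 + κ₂ = rr * (C.q' - d)
  /-- census side condition in LATTICE units (ADDED with `hexpFL`; truncated-subtraction guard): `d ≤ q′` -/
  hdq : d ≤ C.q'
  /-- census identity in LATTICE units (volume window vs the birth credit; REPLACES LW's per-cube row `1 + κᵥ = 2p₀`): the
  credit reads the UPPER (2.5) member `R_j ≤ L·ℓ_j^{r}`, so `1 + r·d + κᵥ = 2p₀` -/
  hexpVL : 1 + rr * d + κᵥ = 2 * C.p₀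
  /-- exponent gaps -/
  hη : 1 ≤ η
  /-- exponent gaps -/
  hη' : 1 ≤ η'
  /-- exponent gaps -/
  hκ : 1 ≤ κ
  /-- exponent gaps -/
  hκ₂ : 1 ≤ κ₂
  /-- exponent gaps -/
  hκᵥ : 1 ≤ κᵥ
  /-- constants: `1 ≤ p₀` -/
  hp₀ : 1 ≤ C.p₀
  /-- signs of print's O(1)s -/
  hγ₀ : 0 < O.γ₀
  /-- signs of print's O(1)s -/
  hA₁ : O.A₁ ≠ 0
  /-- signs -/
  hA₀ : 0 < C.A₀
  /-- signs -/
  hM : 0 < O.M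
  /-- φ-BUDGET, births, run A: the fibre's own share is at most `Φ` discount shares -/
  hφB : ∀ K j d', φB K j d' ≤ Φ * dshare C F.L (ℛ.R K) ((j, 0, d') : PEv)
  /-- φ-BUDGET, renewals, run A -/
  hφR : ∀ K h, φR K h ≤ Φ * dshare C F.L (ℛ.R K) ((h + 1, 1, 0) : PEv)
  /-- φ-BUDGET, births, run B's letters -/
  hφB' : ∀ K j d', φB' K j d' ≤ Φ * dshare C F.L (ℛ.R K) ((j, 0, d') : PEv)
  /-- φ-BUDGET, renewals, run B's letters -/
  hφR' : ∀ K h, φR' K h ≤ Φ * dshare C F.L (ℛ.R K) ((h + 1, 1, 0) : PEv)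
  /-- BIRTH LETTER FLOOR, run A: the sharp birth exponent is at least print's `sBsharp` -/
  hsB : ∀ K j d', sBsharp O m C (D.C ⟨K, F.m, g₀ K⟩).flow.g j d' ≤ sB K j d'
  /-- BIRTH LETTER FLOOR, run B's letters -/
  hsB' : ∀ K j d', sBsharp O m C (D.C ⟨K, F.m, g₀ K⟩).flow.g j d' ≤ sB' K j d'
  /-- (2.7)'s power (NE7-rate row) -/
  p27 : ℕ
  /-- (2.7)'s power is at least one -/
  hp27 : 1 ≤ p27
  /-- display (2.7) per cutoff on the run's couplings (NE7-rate row, like `h29`) -/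
  h27 : ∀ K, K₀ ≤ K → B14.FlowIneq27 (D.C ⟨K, F.m, g₀ K⟩).flow.g β' β₀ p27 K

end Data

end

end Summit.QuantumFields.BalabanUV.T4Continuum.HistoryRealiseCellsRunAssemblyWTVSDataLWR
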